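import Mathlib
import HarnessLib
import HarnessLib.Audit
import Summits.AtomisticToContinuum.Statement

/-!
Route: PesinDefectPricing

CLOSED (retired) 2026-08-15T13:45:24Z by operator:999:1257524 — reason: not-a-thesis: assembly does not conclude the sub-problem Statement — note: D-0027 §2.1 audit (human 2026-08-15: routes that do not decide the summit are removed): the assembly concludes `Literature.MathematicalPhysics.KineticTheory.HydrodynamicLimit`, not the sub-problem statement; a NEW conforming route may be opened from the same idea (generated `closes : … → _root_.Hydr. The file is kept as the record of this route; refuted decls are indexed as negative knowledge (`ledger negatives`).

# Route PesinDefectPricing — u-regularity is priced, not inherited — an N-uniform upper volume lemma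
plus the Kifer–Young Pesin-defect rate make every sustainable local state Pesin-saturating, hence
u-Gibbs, hence Gibbs

X_P = V ∧ KY ∧ R ("it suffices to show"), realising card pesin-defect-prices-u-regularity (spine):
the PRICING decomposition of U1 of
route UGibbsRigidity (URegularLimits, stmt-AtomisticToContinuum-5102/5478), filed as a sibling route
that SHARES the typed frame
(target 0766, assembly 0769), the teeth (EntropyPerParticle 4276) and the affordability budget
(TransferInequality 3924, GibbsInvariance 3926).
V = UpperVolumeLemma (typed, finite N, rank 2): under the invariant homogeneous Gibbs law G_N of N+1
spheres at reduced density σ < σ₀ the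
measure of the initial data whose configurations (ε_N/16)-shadow a given orbit on [t₁,t₂] is ≤
exp(C(N+1) + C·#collisions − Λ) times
that of the kinematic reference set, Λ = Σ over non-grazing collisions of log(1 + |g|τ⁺/ε_N) (the
dilute-gas unstable Jacobian), C
INDEPENDENT OF N. KY = KiferYoungUpper (informal until the infinite-volume objects land, rank 3): V
upgrades by Young's counting to a
large-deviation upper bound for space-time empirical local states in the joint limit (N → ∞, ≍
N^{1/3} collisions per particle) with
rate = Pesin defect i(ν) = λ⁺(ν) − h(ν) per particle per collision time. R = PesinSaturationRigidity
(informal, rank 4): stationary,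
translation-invariant, finite-entropy dilute states with i = 0 are u-regular (infinite-volume
Ledrappier–Young) hence, by URigidity
(stmt-5572), Gibbs mixtures — with a quantitative Pesin gap. Affordability then forces every
macroscopically sustained local state to be
Pesin-saturating, so the Boltzmann hypothesis holds FOR THE STATES THAT OCCUR, which is all OVY's
one-block step consumes (GronwallU
5688) ⇒ RelEntropyVanishing (0766) ⇒ the conjunct (0769).
Lean: `∀ (a₀ θ₀ : Literature.MathematicalPhysics.KineticTheory.T3 → ℝ) (u₀ :
Literature.MathematicalPhysics.KineticTheory.T3 → Literature.MathematicalPhysics.KineticTheory.V3),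
Continuous a₀ → Continuous θ₀ → Continuous u₀ → (∀ x, 0 < a₀ x) → (∀ x, 0 < θ₀ x) → ∃ σ₀ : ℝ, 0 < σ₀
∧ ∀ σ : ℝ, 0 < σ → σ < σ₀ → ∀ (T : ℝ) (ρ θ : ℝ → Literature.MathematicalPhysics.KineticTheory.T3 →
ℝ) (u : ℝ → Literature.MathematicalPhysics.KineticTheory.T3 →
Literature.MathematicalPhysics.KineticTheory.V3),
Literature.MathematicalPhysics.KineticTheory.IsHardSphereEulerSolution σ T ρ u θ → ∀ Φ : (N : ℕ) →
Literature.Analysis.FluidPDE.HardSphereFlow (Literature.Analysis.FluidPDE.Torus.geometry (Fin 3))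
(Literature.MathematicalPhysics.KineticTheory.hsDiameter σ N) (N + 1), (∀ N,
MeasureTheory.IsProbabilityMeasure (Literature.MathematicalPhysics.KineticTheory.localGibbsLaw σ a₀
u₀ θ₀ N (Φ N))) ∧ (Literature.MathematicalPhysics.KineticTheory.TendstoHydroFieldsAt (fun N =>
Literature.MathematicalPhysics.KineticTheory.localGibbsLaw σ a₀ u₀ θ₀ N (Φ N)) Φ ρ u θ 0 → ∀ t ∈
Set.Ico 0 T, ∃ a : Literature.MathematicalPhysics.KineticTheory.T3 → ℝ, (∀ N,
MeasureTheory.IsProbabilityMeasure (Literature.MathematicalPhysics.KineticTheory.localGibbsLaw σ a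
(u t) (θ t) N (Φ N))) ∧ (∀ χ : Literature.MathematicalPhysics.KineticTheory.T3 → ℝ, Continuous χ → ∀
δ : ℝ, 0 < δ → ∃ C : ℝ, 0 < C ∧ ∀ N : ℕ, Literature.MathematicalPhysics.KineticTheory.localGibbsLaw
σ a (u t) (θ t) N (Φ N) {z | δ < |Literature.MathematicalPhysics.KineticTheory.empiricalDensityField
z χ - ∫ x, χ x * ρ t x|} ≤ ENNReal.ofReal (C * Real.exp (-(C⁻¹ * (N + 1)))) ∧
Literature.MathematicalPhysics.KineticTheory.localGibbsLaw σ a (u t) (θ t) N (Φ N) {z | δ <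
‖Literature.MathematicalPhysics.KineticTheory.empiricalMomentumField z χ - ∫ x, (χ x * ρ t x) • u t
x‖} ≤ ENNReal.ofReal (C * Real.exp (-(C⁻¹ * (N + 1)))) ∧
Literature.MathematicalPhysics.KineticTheory.localGibbsLaw σ a (u t) (θ t) N (Φ N) {z | δ <
|Literature.MathematicalPhysics.KineticTheory.empiricalEnergyField z χ - ∫ x, χ x *
Literature.MathematicalPhysics.KineticTheory.totalEnergyDensity (ρ t x) (u t x) (θ t x)|} ≤
ENNReal.ofReal (C * Real.exp (-(C⁻¹ * (N + 1))))) ∧ Filter.Tendsto (fun N : ℕ =>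
InformationTheory.klDiv ((Φ N).lawAt (Literature.MathematicalPhysics.KineticTheory.localGibbsLaw σ
a₀ u₀ θ₀ N (Φ N)) t) (Literature.MathematicalPhysics.KineticTheory.localGibbsLaw σ a (u t) (θ t) N
(Φ N)) / ((N : ENNReal) + 1)) Filter.atTop (nhds 0))`

## Assembly
V (UpperVolumeLemma) → KY (KiferYoungUpper, informal) gives, under G_N, the two-term cost law: a
local behaviour sustained on a patch of
N_P particles over [t₁,t₂] costs ≥ max{static deficit, c·(N+1)^{1/3}(t₂−t₁)·N_P·i(ν)};
TransferInequality + GibbsInvariance make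
only O(N)-cost behaviours visible under local Gibbs data, so every local limit of the evolved law
has i = 0 and finite specific entropy
(PricedBoltzmannHypothesis, support filed after open); R (PesinSaturationRigidity) classifies such
states as Gibbs mixtures; GronwallU
(stmt-5688, OVY's one-block step consuming the classification only for dynamical local limits, large
velocities and virial as in
0781/0782) yields RelEntropyVanishing; the typed assembly is the shared glue 0769 (entropy
inequality, KipnisLandim1999 App. 1).

Rationale: WHY THIS LINE. The Kifer–Young large-deviation principle for hyperbolic systems (Young1990 Thm 1
upper bound: C² + a volume lemma, no hyperbolicity;
Kifer1990; towers: ReybelletYoung2008, MelbourneNicol2008; non-uniform expansion: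
AraujoPacifico2006) has RATE = Pesin defect λ⁺ − h ≥ 0
on invariant measures, vanishing exactly on u-Gibbs/SRB states (LedrappierYoung1985 Thm A,
BowenRuelle1975); its open-system twin is the
escape-rate formula γ = Σλ⁺ − h_KS (GaspardNicolis1990; Gaspard1998 §4.4 eq. (4.64) p. 145, volume
estimate (4.62)). Transplanted with
an explicit dictionary (orbit segment ↦ space-time patch of the N-sphere flow at fixed reduced
density; −log Jᵘ ↦ Σ_collisions
log(1 + |g|τ/ε), the dilute-gas clock model VanzonVanbeijerenDellago1998, VanbeijerenEtAl1997; Bowen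
ball ↦ configuration tube) and
combined with the board's affordability device (Cauchy–Schwarz against the invariant Gibbs law,
TransferInequality of route
SpacetimeExtensivity), it turns the weakest link of UGibbsRigidity — u-regularity of local limits
INHERITED along the non-equilibrium
flow with N-uniform distortion control — into an invoice: non-u-regular behaviour is not forbidden,
it is unaffordable (dynamical price
≍ N^{4/3}·t·i against an O(N) budget), and only an UPPER volume bound is imported (no lower bounds,
no holonomy, no Markov partition, no
mixing rate). Imported area: smooth ergodic theory / thermodynamic formalism (volume lemma, Pesin
defect, Ledrappier–Young) into the
OVY relative-entropy architecture (OllaVaradhanYau1993 §4, KipnisLandim1999 Ch. 6). Versus routes on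
file: UGibbsRigidity files the
inheritance inputs (TemperedCollisions 4275, CollisionMoments 4277) and reserves this decomposition
without filing it; RelEntropyErgodic
asks the classification for ALL finite-entropy states (0779); SpacetimeExtensivity posits
super-extensive closure costs (3921/3923)
with no mechanism — here they are the i > 0 branch of a two-term cost law; no item on the board
states a volume lemma or a
Pesin-defect rate; negatives index empty.

RANKED CRUXES. #0 RelEntropyVanishing (target) — Yau's relative-entropy form of the limit (shared
target of RelEntropyErgodic / UGibbsRigidity / KineticWindows / …, stmt-AtomisticToContinuum-0766):
∀ profiles ∃ σ₀ ∀ σ < σ₀ ∀ classical hs-Euler solutions on [0,T) ∀ flows, the local Gibbs laws are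
probability measures and, given the LLN at t = 0, for every t < T there is an activity profile a_t
whose local Gibbs law concentrates exponentially around (ρ, ρu, E)(t) and H(f^N_t | localGibbs(a_t,
u_t, θ_t))/(N+1) → 0. Reached here as V → KY → R → PricedBoltzmannHypothesis (support, filed after
open) → GronwallU (stmt-5688) → this. (why it might fail: entropy production ≥ cN before the first
shock for some smooth data kills every entropy route; or sustained local states are Pesin-saturating
yet non-Gibbs (¬PesinSaturationRigidity), leaving the one-block step without an ergodic theorem.)
[OllaVaradhanYau1993, Yau1991, Spohn1991, KipnisLandim1999]
#2 UpperVolumeLemma (crux) — N-UNIFORM UPPER VOLUME LEMMA (card crux 1, global form). There is σ₀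
such that for σ < σ₀ and θe > 0 there is C with, for ALL N, all hard-sphere flows Φ of N+1 spheres
of diameter ε = ε_N on 𝕋³, all windows t₁ < t₂ and G_N-a.e. z (G_N = localGibbsLaw σ 1 0 θe, the
invariant homogeneous canonical Gibbs law): G_N{z′ : every particle of Φ_s z′ stays within torus
distance ε/16 of the same particle of Φ_s z for all s ∈ [t₁,t₂]} ≤ exp(C(N+1) + C·K − Λ) · G_N{z′ :
at time t₁ positions within ε/16 and velocities within ε/(8·(first collision time of that particle
after t₁, capped at t₂, minus t₁))}, where K = number of collisions of the orbit of z in [t₁,t₂] and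
Λ = Σ over its NON-GRAZING collisions (|cos φ| ≥ 1/2, i.e. ε|g| ≤ 2|⟨x_i − x_j, g⟩|) of log(1 +
|g|·τ⁺/ε), g the relative velocity of the pair and τ⁺ the time to the next collision involving
either partner (capped at t₂). One transverse power only and τ⁺ cut at either partner's next
collision are deliberate undercharges (true clock-model exponent: 2 per collision); e^{C·K} absorbs
O(1) per collision, e^{C(N+1)} the first/last flights. [difficulty: L] (why it might fail: the tube
measure must factor over collisions with O(1) distortion PER COLLISION uniformly in N (6N dims):
earlier grazing/near-simultaneous collisions may focus the conditional law of later impact offsets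
below scale ε²/(|g|τ⁺); no N-uniform growth lemma exists even for N discs (BalintEtAl2002).)
[Young1990, BowenRuelle1975, ChernovDolgopyat2009, BalintEtAl2002, SinaiChernov1987,
VanzonVanbeijerenDellago1998, Gaspard1998]
#5 EntropyPerParticle (crux) — POSITIVE DYNAMICAL ENTROPY PER PARTICLE PER COLLISION, N-UNIFORM
(shared with route UGibbsRigidity, stmt-AtomisticToContinuum-4276; the teeth of pricing: if the
entropy — equivalently, by the Pesin formula for the smooth invariant law at finite N, the
positive-Lyapunov sum — per collision tended to 0 along N → ∞, the Pesin-defect rate would price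
nothing): there is σ₀ such that for σ < σ₀ there is c > 0 with, for all N ≥ 1 and all flows Φ, a
finite measurable partition whose Kolmogorov–Sinai entropy rate under the equilibrium Gibbs law
(activity 1, drift 0, temperature 1) for the macroscopic time-one map Φ₁ is ≥ c (N+1)^{4/3} = c′ ×
(collisions per unit macroscopic time). The averaged shadow of UpperVolumeLemma's expansion half
(E_G Λ ≍ (N+1)^{4/3}(t₂−t₁) log(1/σ³)). [difficulty: L] (why it might fail: Wojtkowski1988 (pp.
133–134) gets only ~√N·(rate): cone/Q-form methods measure each collision against the SYSTEM's
previous collision (time ~1/(Nν)), not the particle's (~1/ν); an N-uniform bound needs per-particle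
locality of expansion — the same wall as UpperVolumeLemma.) [Wojtkowski1988, SinaiChernov1987,
Chernov1997, VanbeijerenEtAl1997, LedrappierYoung1985]
#9 TransferInequality (support) — STATIC L² BUDGET = AFFORDABILITY (shared with route
SpacetimeExtensivity, stmt-AtomisticToContinuum-3924): for continuous positive profiles and θe with
θ₀ < 2θe pointwise, ∃ σ₀ ∀ σ < σ₀ ∃ C ∀ N, Φ and EVERY set S: localGibbsLaw σ a₀ u₀ θ₀ N Φ S ² ≤
e^{C(N+1)} · G_N(S) (Cauchy–Schwarz against the invariant law; an event of G_N-cost > C(N+1) per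
unit is invisible under local Gibbs data at ALL times, by GibbsInvariance). [difficulty: M]
[KipnisLandim1999, BodineauGallagherSaintraymond2017, Ruelle1969]
#9 GibbsInvariance (support) — the homogeneous canonical Gibbs law G_N = localGibbsLaw σ 1 0 θe N Φ
is preserved by Φ.flow t for every t (shared with route SpacetimeExtensivity,
stmt-AtomisticToContinuum-3926; Liouville invariance + energy conservation + conull good set). The
invariant reference law of the whole route: it makes the static term of the cost law
time-independent and is the measure of UpperVolumeLemma. [difficulty: provable-now] [Alexander1975,
CercignaniIllnerPulvirenti1994]

TWO-LAYER PLAN. KiferYoungUpper ⇐ LocalCounting (separated-set counting of patch histories realises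
the space-time entropy DENSITY; boundary terms
O(N^{-1/3})) → DefectLsc (i lower semicontinuous along the joint limit: specific entropy u.s.c.,
λ⁺-density continuous given
integrable log(1 + |g|τ/ε) near grazing — a TemperedCollisions 4275-type input) → KiferYoungUpper (k
= 2). PesinSaturationRigidity ⇐
InfiniteVolumeLY (i = 0 + finite specific entropy ⇒ u-regular) → URigidity (stmt-5572, shared with
UGibbsRigidity) → PesinGap
(quantitative stability) (k = 3). UpperVolumeLemma ⇐ TwoBodyTube (one charged collision against a
frozen environment: the factor
(1 + |g|τ⁺/ε)^{-1} with O(1) distortion on non-grazing cells) → TubeFactorisation (conditional laws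
of successive impact offsets stay
spread at scale ε/16, N-uniformly) → UpperVolumeLemma (k = 2). Flux-level alternative assembly (not
filed): the cost law with
PesinGap gives MomentumClosureCost / EnergyClosureCost (stmt-3921/3923, route SpacetimeExtensivity)
with explicit rate
min{c N_P log N (static, collisionless corners), c(δ)(N+1)^{4/3}(t₂−t₁)}. Nothing here is filed now.

KILL CRITERIA. ¬UpperVolumeLemma by a distortion blow-up GROWING WITH N (e.g. through the ≍ N^{5/3}
global rate of near-simultaneous collisions) kills
the global lemma: PIVOT once to a patch-local volume lemma (restate UpperVolumeLemma for the
particles of a mesoscopic region with the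
exterior as a boundary condition); if that is refuted too, close `refuted:UpperVolumeLemma`. A
COLLIDING ZERO-RATE CONSPIRACY — a
stationary translation-invariant finite-entropy state of the hard-sphere dynamics with collisions at
positive rate, i = 0 and
non-Euler flux (¬PesinSaturationRigidity) — closes the route `refuted:PesinSaturationRigidity` and
kills UGibbsRigidity's URigidity
with it. ¬EntropyPerParticle (entropy per collision → 0 at fixed σ) empties the rate of content:
close unless a formalisation
artefact. RelEntropyVanishing refuted (entropy production ≥ cN pre-shock) closes this and every
entropy route. URegularLimits (5102)
proved by inheritance, or GibbsErgodicity (0779) proved, moots the route (superseded by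
UGibbsRigidity / RelEntropyErgodic).

NOT DECOMPOSED YET. The infinite-volume objects (Alexander flow defn-InfiniteHardSphereFlow,
u-regular states defn-URegularState, Gibbs laws
defn-HardSphereGibbsState, and the NEW Pesin-defect density defn request below) — so KY and R are
filed informal and unsplit right
after open; the patch-local version of V (only needed if the global one dies); the
lower-semicontinuity lemma for i; the Cesàro /
convexity bookkeeping passing 'i = 0' to OVY's averaged limit points (i is affine on
translation-invariant states); the re-posed
large-velocity bound (0781) and virial identification (0782) inside GronwallU (shared with
UGibbsRigidity / RelEntropyErgodic); the
retrodictions of the cost law (Galilean discount of collisionless corners, N_P log N static price,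
one-long-corner — the last only as
a conjecture needing decorrelation under G_N, per the triage note); constants σ₀ (cluster-expansion
radius), c in KY.

CHEAPEST FALSIFIER. (i) TWO DISCS ON 𝕋² / TWO SPHERES ON 𝕋³ (N+1 = 2): UpperVolumeLemma reduces to a
tube estimate for one point particle in a periodic
array of one spherical scatterer (infinite-horizon periodic Lorentz gas); if the charged factor (1 +
|g|τ⁺/ε)^{-1} per non-grazing
collision fails THERE (astigmatism, BalintEtAl2002; infinite-horizon corridors), the dictionary is
wrong before any N-uniformity —
refuters should test this first (growth lemmas for 3-D dispersing billiards, BalintToth2008). (ii)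
NUMERICS (kit, not run here —
hub is compute-free and this is a one-shot planning seat): cloning / tube-sampling for N = 64…512
hard spheres at σ³ = 0.05: fit
log G_N(tube)/(reference) + Λ against C(N+1) + C·K and watch whether the fitted C drifts with N.
(iii) LOOKUP: an N-linear lower
bound h_N ≥ c·N·ν for the KS entropy of N hard balls at small packing in print (Chernov 2000
'Entropy values and entropy bounds',
acq-02322 of UGibbsRigidity) would make EntropyPerParticle `known`.

NUMBERS. Scaling (macroscopic units; N+1 spheres of diameter ε_N = σ(N+1)^{−1/3} on 𝕋³): collision
rate per particle ν_N ≍ σ²√θ (N+1)^{1/3};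
collisions in [t₁,t₂] K ≍ (N+1)^{4/3}(t₂−t₁); mean free path ℓ ≍ (N+1)^{-1/3}/σ², so |g|τ⁺/ε ≍ ℓ/ε ≍
σ^{-3} and the typical charge
per non-grazing collision is log(1 + ℓ/ε) ≍ 3 log(1/σ) (clock model: λ_max ≍ ν·ln(1/ñ), h_KS/N =
ν[−A ln ñ + B], ñ = nσ³,
VanbeijerenEtAl1997, VanzonVanbeijerenDellago1998; Chernov1997 for billiard entropy vs mean free
path); non-grazing fraction: cos φ has
flux density 2cos φ d(cos φ), so P(|cos φ| ≥ 1/2) = 3/4; hence E_G Λ ≍ (9/4)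
log(1/σ)·(N+1)^{4/3}(t₂−t₁) ≫ C·K for σ small —
the lemma has content iff C < (9/4)·log(1/σ), which fixes how small σ₀ must be. Tube arithmetic: r =
ε/16, pair offsets ≤ 2r = ε/8
< (1 − √3/2)ε ≈ 0.134ε, so tube members cannot skip a charged (|cos φ| ≥ 1/2, impact parameter ≤
0.866ε) collision. Budgets:
affordability O(N) (TransferInequality) vs dynamical price ≍ (N+1)^{4/3} t·i vs static price of
collisionless patches ≍ N_P log N
(card collisionless-corners-log-price C1). Known: h_N > 0 at each N (SinaiChernov1987);
Wojtkowski1988 lower bound ≍ √N only; LD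
upper bound with rate h − Σλ⁺ needs only C² + volume lemma (Young1990 Thm 1); escape rate = Σλ⁺ −
h_KS (Gaspard1998 (4.64)).
Items at open: 6 typed (target, 2 cruxes, 2 supports, assembly) + 4 informal filed right after open
(2 cruxes, 2 supports) = 10 ≤ 15.

DEFINITION REQUESTS. Existing, wanted here too: defn-InfiniteHardSphereFlow (D1), defn-URegularState
(D2), defn-HardSphereGibbsState (D3) of route
UGibbsRigidity. NEW (filed right after open): defn-PesinDefectDensity — for a translation-invariant
law ν on PointConfig(ℝ³×ℝ³)
invariant under the infinite hard-sphere flow, of finite density and specific energy: (a) the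
space-time Kolmogorov–Sinai entropy
density h(ν) (entropy per unit time per unit volume, Sinai–Chernov 1982 as cited in Wojtkowski1988
p. 133); (b) the positive-Lyapunov
(unstable-Jacobian) density λ⁺(ν) (thermodynamic limit of Σλ⁺ per unit volume, or the ν-intensity of
log Jᵘ on local unstable
plaques of defn-URegularState); (c) the Pesin defect i(ν) := λ⁺(ν) − h(ν) with the Ruelle inequality
i ≥ 0 as a named fact;
finite-N deliverable first: for a HardSphereFlow on 𝕋³ and a flow-invariant probability law μ,
i_N(μ) := (Σλ⁺(μ) − h_μ(Φ₁))/(N+1)^{4/3}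
via the derivative cocycle of collidePair ∘ freeFlight on the good set (KatokEtAl1986 Part V for
billiard-type maps).

Novelty: Searches (2026-08-15): `lit search --hybrid "large deviations hyperbolic billiards volume lemma
Pesin entropy formula rate function"`
(12 held books: Gaspard1998 pp. 131–152 READ — LD formalism, volume estimate (4.62), escape-rate
formula (4.64); Dorfman1999 p. 196 READ;
BarreiraPesin2023; KipnisLandim1999); `lit galaxy search "volume lemma" --star all` (11 rows;
relevant: Araújo arXiv:math/0607771 LD
bound over non-uniformly expanding base → AraujoPacifico2006); `lit galaxy search "large deviations
for billiards" --star all` (0);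
`lit frontier AtomisticToContinuum --since 2021` (30 rows, none ergodic-theoretic;
CanestrariLiveraniOlla2026 only deterministic hit);
`lit bridges AtomisticToContinuum --cross any` (30 rows, none relevant); `lit search --source all
"large deviations non-uniformly
hyperbolic Rey-Bellet Young"` (searchd rc 75, down); grep of all 30 Theses files of the sub for
Bowen / volume lemma / Pesin (no item
states a volume lemma or a Pesin-defect rate); `ledger negatives` (0); the card's and the triage
refuter's searches (117 cards; Kifer
only as the variational SCGF template in ld-drude / spacetime; Pesin only as rigidity in the parent
card).
Nearest prior art found: Young1990 Thm 1 / Kifer1990 (LD for dynamical systems, upper bound with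
rate h − Σλ⁺ from C² + volume lemma);
LedrappierYoung1985 Thm A (zero defect ⇔ SRB); BowenRuelle1975 (volume lemma, SRB as equilibrium
state); GaspardNicolis1990 and
Gaspard1998 §4.4 (escape rate = Σλ⁺ − h_KS: the Pesin defect  [refs: math/0607771, Gaspard1998, Dorfman1999, BarreiraPesin2023, KipnisLandim1999, AraujoPacifico2006, CanestrariLiveraniOlla2026, Young1990, Kifer1990, LedrappierYoung1985, BowenRuelle1975, GaspardNicolis1990, ReybelletYoung2008, MelbourneNicol2008, BricmontKupiainen1996, KellerLiverani2009]

Barriers (technique_class: thermodynamic-formalism large-deviations volume-lemma): - technique_class: thermodynamic-formalism large-deviations volume-lemma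
- Literature.Barriers.AtomisticToContinuum.BoltzmannHypothesisBarrier: met head-on in a smaller
class and the restriction is DERIVED: the classification is asked only for Pesin-saturating
finite-entropy states (PesinSaturationRigidity), and pricing (UpperVolumeLemma + KiferYoungUpper +
TransferInequality) shows the dynamics cannot afford anything else; the printed kernels (ideal gas
with arbitrary velocity law, hard rods) have no expanding directions — they are the i = 0
COLLISIONLESS phase, excluded from R by the collision/finite-entropy hypotheses and priced
statically (N_P log N ≫ N) when realised as corners inside the gas; honest residue: R(a) is the
barrier's substance in hyperbolic form.
- Literature.Barriers.AtomisticToContinuum.BoltzmannHypothesisBarrierNarrow: the flux-level closure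
it isolates is exactly what R(b) (the Pesin gap: flux defect ≥ δ ⇒ i ≥ c(δ)) quantifies; conceded
that no printed source proves it — the bet is that restricting to i = 0 states makes
Ledrappier–Young/Hopf rigidity available where the bare classification (0779) has none.
- Literature.Barriers.AtomisticToContinuum.MacroErgodicityBarrier: same remark at Euler scaling: its
Definition-1 class of regular stationary states is cut down to the affordable Pesin-saturating
subclass; no Dirichlet form or sector condition is used; oscillator chains (no hyperbolicity) are
outside the claim.
- Literature.Barriers.AtomisticToContinu

History (route lifecycle, newest last):
- 2026-08-15T13:45:24Z · CLOSED retired — not-a-thesis: assembly does not conclude the sub-problem Statement (operator:999:1257524)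

sub-problem: HydrodynamicLimit · status: closed(retired) · opened planner-plancard-AtomisticToContinuum-Hydrody-6f4b7d8b-0 2026-08-15T12:13:11Z · rev 1 · ledger route-AtomisticToContinuum-PesinDefectPricing
GENERATED by the gate from the ledger (D-0016/17). Provers cite these decls: `theorem foo : Summit.AtomisticToContinuum.HydrodynamicLimit.Theses.PesinDefectPricing.<Decl> := …` in Summits/AtomisticToContinuum/HydrodynamicLimit/Theorems/<Name>.lean.
-/

namespace Summit.AtomisticToContinuum.HydrodynamicLimit.Theses.PesinDefectPricing

open scoped BigOperators Topology Manifold Classical MeasureTheory ProbabilityTheory Matrix InnerProductSpace ComplexConjugate ContinuousMap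
open Filter Set Function TopologicalSpace MeasureTheory

attribute [summit_statement] _root_.HydrodynamicLimit

/-- item stmt-AtomisticToContinuum-0766 · target · rank 0 · open · by planner
why it might fail: entropy production ≥ cN before the first shock for some smooth data kills every entropy route; or sustained local states are Pesin-saturating yet non-Gibbs (¬PesinSaturationRigidity), leaving the one-block step without an ergodic theorem.
sources: OllaVaradhanYau1993, Yau1991, Spohn1991, KipnisLandim1999
[target] X_RE: for all continuous profiles ∃ σ₀ ∀ σ<σ₀ ∀ classical hs-Euler solutions on [0,T) ∀
flows: the initial local Gibbs laws are probability measures and, if their fields converge at t=0,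
then ∀ t<T ∃ activity profile a_t such that the reference local Gibbs law (a_t, u_t, θ_t) is a
probability measure whose empirical density/momentum/energy fields concentrate exponentially (≤ C
e^{-(N+1)/C}) around (ρ,ρu,E)(t), and klDiv(lawAt Φ_N (localGibbs a₀u₀θ₀) t ‖ localGibbs a_t u_t
θ_t)/(N+1) → 0. Yau1991; OllaVaradhanYau1993 Thm 1.1 (with noise). -/
@[route_item "route-AtomisticToContinuum-PesinDefectPricing"]
def RelEntropyVanishing : Prop :=
  ∀ (a₀ θ₀ : Literature.MathematicalPhysics.KineticTheory.T3 → ℝ) (u₀ : Literature.MathematicalPhysics.KineticTheory.T3 → Literature.MathematicalPhysics.KineticTheory.V3), Continuous a₀ → Continuous θ₀ → Continuous u₀ → (∀ x, 0 < a₀ x) → (∀ x, 0 < θ₀ x) → ∃ σ₀ : ℝ, 0 < σ₀ ∧ ∀ σ : ℝ, 0 < σ → σ < σ₀ → ∀ (T : ℝ) (ρ θ : ℝ → Literature.MathematicalPhysics.KineticTheory.T3 → ℝ) (u : ℝ → Literature.MathematicalPhysics.KineticTheory.T3 → Literature.MathematicalPhysics.KineticTheory.V3), Literature.MathematicalPhysics.KineticTheory.IsHardSphereEulerSolution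 σ T ρ u θ → ∀ Φ : (N : ℕ) → Literature.Analysis.FluidPDE.HardSphereFlow (Literature.Analysis.FluidPDE.Torus.geometry (Fin 3)) (Literature.MathematicalPhysics.KineticTheory.hsDiameter σ N) (N + 1), (∀ N, MeasureTheory.IsProbabilityMeasure (Literature.MathematicalPhysics.KineticTheory.localGibbsLaw σ a₀ u₀ θ₀ N (Φ N))) ∧ (Literature.MathematicalPhysics.KineticTheory.TendstoHydroFieldsAt (fun N => Literature.MathematicalPhysics.KineticTheory.localGibbsLaw σ a₀ u₀ θ₀ N (Φ N)) Φ ρ u θ 0 → ∀ t ∈ Set.Ico 0 T, ∃ a : Literature.MathematicalPhysics.KineticTheory.T3 → ℝ, (∀ N, MeasureTheory.IsProbabilityMeasure (Literature.MathematicalPhysics.KineticTheory.localGibbsLaw σ a (u t) (θ t) N (Φ N))) ∧ (∀ χ : Literature.MathematicalPhysics.KineticTheory.T3 → ℝ, Continuous χ → ∀ δ : ℝ, 0 < δ → ∃ C : ℝ, 0 < C ∧ ∀ N : ℕ, Literature.MathematicalPhysics.KineticTheory.localGibbsLaw σ a (u t) (θ t) N (Φ N) {z | δ < |Literature.MathematicalPhysics.KineticTheory.empiricalDensityField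 z χ - ∫ x, χ x * ρ t x|} ≤ ENNReal.ofReal (C * Real.exp (-(C⁻¹ * (N + 1)))) ∧ Literature.MathematicalPhysics.KineticTheory.localGibbsLaw σ a (u t) (θ t) N (Φ N) {z | δ < ‖Literature.MathematicalPhysics.KineticTheory.empiricalMomentumField z χ - ∫ x, (χ x * ρ t x) • u t x‖} ≤ ENNReal.ofReal (C * Real.exp (-(C⁻¹ * (N + 1)))) ∧ Literature.MathematicalPhysics.KineticTheory.localGibbsLaw σ a (u t) (θ t) N (Φ N) {z | δ < |Literature.MathematicalPhysics.KineticTheory.empiricalEnergyField z χ - ∫ x, χ x * Literature.MathematicalPhysics.KineticTheory.totalEnergyDensity (ρ t x) (u t x) (θ t x)|} ≤ ENNReal.ofReal (C * Real.exp (-(C⁻¹ * (N + 1))))) ∧ Filter.Tendsto (fun N : ℕ => InformationTheory.klDiv ((Φ N).lawAt (Literature.MathematicalPhysics.KineticTheory.localGibbsLaw σ a₀ u₀ θ₀ N (Φ N)) t) (Literature.MathematicalPhysics.KineticTheory.localGibbsLaw σ a (u t) (θ t) N (Φ N)) / ((N : ENNReal) + 1)) Filter.atTop (nhds 0))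

/-- item stmt-AtomisticToContinuum-7637 · crux · rank 2 · closed · moot by None · by planner
why it might fail: the tube measure must factor over collisions with O(1) distortion PER COLLISION uniformly in N (6N dims): earlier grazing/near-simultaneous collisions may focus the conditional law of later impact offsets below scale ε²/(|g|τ⁺); no N-uniform growth lemma exists even for N discs (BalintEtAl2002).
sources: Young1990, BowenRuelle1975, ChernovDolgopyat2009, BalintEtAl2002, SinaiChernov1987, VanzonVanbeijerenDellago1998
[crux] N-UNIFORM UPPER VOLUME LEMMA (card crux 1, global form). There is σ₀ such that for σ < σ₀ and
θe > 0 there is C with, for ALL N, all hard-sphere flows Φ of N+1 spheres of diameter ε = ε_N on 𝕋³,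
all windows t₁ < t₂ and G_N-a.e. z (G_N = localGibbsLaw σ 1 0 θe, the invariant homogeneous
canonical Gibbs law): G_N{z′ : every particle of Φ_s z′ stays within torus distance ε/16 of the same
particle of Φ_s z for all s ∈ [t₁,t₂]} ≤ exp(C(N+1) + C·K − Λ) · G_N{z′ : at time t₁ positions
within ε/16 and velocities within ε/(8·(first collision time of that particle after t₁, capped at
t₂, minus t₁))}, where K = number of collisions of the orbit of z in [t₁,t₂] and Λ = Σ over its
NON-GRAZING collisions (|cos φ| ≥ 1/2, i.e. ε|g| ≤ 2|⟨x_i − x_j, g⟩|) of log(1 + |g|·τ⁺/ε), g the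
relative velocity of the pair and τ⁺ the time to the next collision involving either partner (capped
at t₂). One transverse power only and τ⁺ cut at either partner's next collision are deliberate
undercharges (true clock-model exponent: 2 per collision); e^{C·K} absorbs O(1) per collision,
e^{C(N+1)} the first/last flights. [difficulty: L] -/
@[route_item "route-AtomisticToContinuum-PesinDefectPricing"]
def UpperVolumeLemma : Prop :=
  ∃ σ₀ : ℝ, 0 < σ₀ ∧ ∀ σ : ℝ, 0 < σ → σ < σ₀ → ∀ θe : ℝ, 0 < θe → ∃ C : ℝ, ∀ (N : ℕ) (Φ : Literature.Analysis.FluidPDE.HardSphereFlow (Literature.Analysis.FluidPDE.Torus.geometry (Fin 3)) (Literature.MathematicalPhysics.KineticTheory.hsDiameter σ N) (N + 1)) (t₁ t₂ : ℝ), t₁ < t₂ → ∀ᵐ z ∂(Literature.MathematicalPhysics.KineticTheory.localGibbsLaw σ (fun _ => 1) (fun _ => 0) (fun _ => θe) N Φ), (let ε : ℝ := Literature.MathematicalPhysics.KineticTheory.hsDiameter σ N; let G := Literature.Analysis.FluidPDE.Torus.geometry (Fin 3); let μ := Literature.MathematicalPhysics.KineticTheory.localGibbsLaw σ (fun _ =>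 1) (fun _ => 0) (fun _ => θe) N Φ; let γ : ℝ → Literature.Analysis.FluidPDE.Config (N + 1) (Fin 3) Literature.MathematicalPhysics.KineticTheory.T3 := fun s => Φ.flow s z; let nextColl : ℝ → Fin (N + 1) → Fin (N + 1) → ℝ := fun τ i j => sInf ({s : ℝ | τ < s ∧ ∃ k l : Fin (N + 1), k ≠ l ∧ (k = i ∨ k = j) ∧ γ s ∈ Literature.Analysis.FluidPDE.contactSet G (N + 1) ε k l} ∪ {t₂}); let firstColl : Fin (N + 1) → ℝ := fun i => sInf ({s : ℝ | t₁ < s ∧ ∃ l : Fin (N + 1), i ≠ l ∧ γ s ∈ Literature.Analysis.FluidPDE.contactSet G (N + 1) ε i l} ∪ {t₂}); let Λ : ℝ := ∑ᶠ τ ∈ Literature.Analysis.FluidPDE.collisionTimes G ε γ ∩ Set.Icc t₁ t₂, ∑ i : Fin (N + 1), ∑ j : Fin (N + 1), (if i < j ∧ γ τ ∈ Literature.Analysis.FluidPDE.contactSet G (N + 1) ε i j ∧ ε * ‖(γ τ i).2 - (γ τ j).2‖ ≤ 2 * |inner ℝ (G.sepVec (γ τ i).1 (γ τ j).1) ((γ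 τ i).2 - (γ τ j).2)| then Real.log (1 + ‖(γ τ i).2 - (γ τ j).2‖ * (nextColl τ i j - τ) / ε) else 0); let K : ℝ := (Literature.Analysis.FluidPDE.numCollisions G ε γ t₁ t₂ : ℝ); μ {z' | ∀ s ∈ Set.Icc t₁ t₂, ∀ i : Fin (N + 1), Literature.Analysis.FluidPDE.Torus.euclidDist (Φ.flow s z' i).1 (γ s i).1 ≤ ε / 16} ≤ ENNReal.ofReal (Real.exp (C * (N + 1) + C * K - Λ)) * μ {z' | ∀ i : Fin (N + 1), Literature.Analysis.FluidPDE.Torus.euclidDist (Φ.flow t₁ z' i).1 (γ t₁ i).1 ≤ ε / 16 ∧ ‖(Φ.flow t₁ z' i).2 - (γ t₁ i).2‖ ≤ ε / (8 * (firstColl i - t₁))})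

-- item stmt-AtomisticToContinuum-8207 · crux · rank 3 · closed · moot by None · by planner — informal only, no Lean statement yet:
--   [crux] KIFER–YOUNG UPPER BOUND IN THE JOINT LIMIT (card pesin-defect-prices-u-regularity crux 2;
--   rank 3; INFORMAL until defn-InfiniteHardSphereFlow, defn-URegularState and defn-PesinDefectDensity
--   land). Setting: σ < σ₀, the invariant homogeneous Gibbs laws G_N = localGibbsLaw σ 1 0 θe, a
--   macroscopic window [t₁,t₂], and the SPACE-TIME EMPIRICAL LOCAL STATE R_N(z) of the orbit: the
--   average over particles i and times s ∈ [t₁,t₂] of the Dirac mass at the configuration Φ_s z seen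
--   from particle i (recentred at x_i(s), positions blown up by ε_N⁻¹: unit spheres at density σ³), a
--   probability law on Poi

-- item stmt-AtomisticToContinuum-8209 · crux · rank 4 · closed · moot by None · by planner — informal only, no Lean statement yet:
--   [crux] PESIN SATURATION ⇒ GIBBS, WITH A GAP (card pesin-defect-prices-u-regularity cruxes 3–4; rank
--   4; INFORMAL until defn-InfiniteHardSphereFlow, defn-URegularState, defn-HardSphereGibbsState,
--   defn-PesinDefectDensity land; foreseen split InfiniteVolumeLY → URigidity
--   (stmt-AtomisticToContinuum-5572, route UGibbsRigidity) → PesinGap). (a) QUALITATIVE: there is η₀ > 0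
--   such that every translation-invariant probability law ν on PointConfig(ℝ³ × ℝ³) (unit diameter, d =
--   3; NOT general d — hard rods are a counterexample in d = 1) supported on Alexander-good
--   configurations and invariant under the infi

/-- item stmt-AtomisticToContinuum-4276 · crux · rank 5 · closed · moot by None · by planner
why it might fail: Wojtkowski1988 (pp. 133–134) gets only ~√N·(rate): cone/Q-form methods measure each collision against the SYSTEM's previous collision (time ~1/(Nν)), not the particle's (~1/ν); an N-uniform bound needs per-particle locality of expansion — the same wall as UpperVolumeLemma.
sources: Wojtkowski1988, SinaiChernov1987, Chernov1997, VanbeijerenEtAl1997, LedrappierYoung1985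
[crux] POSITIVE DYNAMICAL ENTROPY PER PARTICLE PER COLLISION, N-UNIFORM (teeth of the u-regular
class; the specific entropy of Sinai–Chernov's infinite equilibrium dynamics is positive): there is
σ₀ such that for σ < σ₀ there is c > 0 with, for all N ≥ 1 (at least two spheres; one free particle
has zero entropy) and all flows Φ, a finite measurable partition P of phase space whose
Kolmogorov–Sinai entropy rate under the equilibrium Gibbs law (activity 1, drift 0, temperature 1)
for the macroscopic time-one map Φ₁ satisfies liminf_n n⁻¹ H(P ∨ Φ₁⁻¹P ∨ … ∨ Φ₁^(−(n−1))P) ≥ c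
(N+1)^(4/3) = c' × (number of collisions per unit macroscopic time). [difficulty: L] -/
@[route_item "route-AtomisticToContinuum-PesinDefectPricing"]
def EntropyPerParticle : Prop :=
  ∃ σ₀ : ℝ, 0 < σ₀ ∧ ∀ σ : ℝ, 0 < σ → σ < σ₀ → ∃ c : ℝ, 0 < c ∧ ∀ (N : ℕ) (Φ : Literature.Analysis.FluidPDE.HardSphereFlow (Literature.Analysis.FluidPDE.Torus.geometry (Fin 3)) (Literature.MathematicalPhysics.KineticTheory.hsDiameter σ N) (N + 1)), 1 ≤ N → ∃ (k : ℕ) (P : Fin k → Set (Literature.Analysis.FluidPDE.Config (N + 1) (Fin 3) Literature.MathematicalPhysics.KineticTheory.T3)), (∀ i, MeasurableSet (P i)) ∧ Pairwise (Function.onFun Disjoint P) ∧ (⋃ i, P i) = Set.univ ∧ c * ((N : ℝ) + 1) ^ (4 / 3 : ℝ) ≤ Filter.liminf (fun n : ℕ => (n : ℝ)⁻¹ * ∑ w : Fin n → Fin k, -((Literature.MathematicalPhysics.KineticTheory.localGibbsLaw σ (fun _ => 1) (fun _ => 0) (fun _ => 1) N Φ).real (⋂ m : Fin n, (Φ.flow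 1)^[m.val] ⁻¹' P (w m)) * Real.log ((Literature.MathematicalPhysics.KineticTheory.localGibbsLaw σ (fun _ => 1) (fun _ => 0) (fun _ => 1) N Φ).real (⋂ m : Fin n, (Φ.flow 1)^[m.val] ⁻¹' P (w m))))) Filter.atTop

/-- item stmt-AtomisticToContinuum-3924 · support · rank 9 · closed · moot by None · by planner
sources: KipnisLandim1999, BodineauGallagherSaintraymond2017, Ruelle1969
[support] STATIC L² BUDGET (the transfer): for continuous positive profiles and any θe with θ₀ < 2θe
pointwise, ∃ σ₀ ∀ σ<σ₀ ∃ C ∀ N, Φ and EVERY set S of configurations: localGibbsLaw σ a₀ u₀ θ₀ N Φ S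
² ≤ e^{C(N+1)} · localGibbsLaw σ 1 0 θe N Φ S. Proof sketch: Cauchy–Schwarz LG(S)² ≤ (∫(dLG/dG)²
dG)·G(S) (outer measure: pass to a G-measurable hull); ∫(dLG/dG)²dG = Z_G·Z_mix/Z_LG² with Z_mix the
positional partition function of the weight a₀(x)²∫M_{u₀,θ₀}²/M_{0,θe}dv (finite iff θ₀ < 2θe);
upper bounds Z ≤ (∫weight)^{N+1}, lower bound Z_LG ≥ (min weight)^{N+1}·FreeVol ≥ (min
weight)^{N+1}(1 − (4π/3)σ³)^{N+1} by sequential insertion. Tools: HardSphereEulerProofs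
(posPartition, gaussMeasure). [difficulty: M] [provable-now] -/
@[route_item "route-AtomisticToContinuum-PesinDefectPricing"]
def TransferInequality : Prop :=
  ∀ (a₀ θ₀ : Literature.MathematicalPhysics.KineticTheory.T3 → ℝ) (u₀ : Literature.MathematicalPhysics.KineticTheory.T3 → Literature.MathematicalPhysics.KineticTheory.V3), Continuous a₀ → Continuous θ₀ → Continuous u₀ → (∀ x, 0 < a₀ x) → (∀ x, 0 < θ₀ x) → ∀ θe : ℝ, (∀ x, θ₀ x < 2 * θe) → ∃ σ₀ : ℝ, 0 < σ₀ ∧ ∀ σ : ℝ, 0 < σ → σ < σ₀ → ∃ C : ℝ, ∀ (N : ℕ) (Φ : Literature.Analysis.FluidPDE.HardSphereFlow (Literature.Analysis.FluidPDE.Torus.geometry (Fin 3)) (Literature.MathematicalPhysics.KineticTheory.hsDiameter σ N) (N + 1)) (S : Set (Literature.Analysis.FluidPDE.Config (N + 1) (Fin 3) Literature.MathematicalPhysics.KineticTheory.T3)), Literature.MathematicalPhysics.KineticTheory.localGibbsLaw σ a₀ u₀ θ₀ N Φ S ^ 2 ≤ ENNReal.ofReal (Real.exp (C * (N + 1)))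 * Literature.MathematicalPhysics.KineticTheory.localGibbsLaw σ (fun _ => 1) (fun _ => 0) (fun _ => θe) N Φ S

/-- item stmt-AtomisticToContinuum-3926 · support · rank 9 · closed · moot by None · by planner
sources: Alexander1975, CercignaniIllnerPulvirenti1994
[support] the homogeneous canonical Gibbs law localGibbsLaw σ 1 0 θe N Φ (density ∝ 1_{no
overlap}·exp(−configEnergy/θe) w.r.t. Liouville) is preserved by Φ.flow t for every t:
HardSphereFlow.measurePreserving (Liouville) + IsHardSphereTrajectory.configEnergy_eq_holds (energy)
+ good ⊆ hardSphereDomain conull; zero-measure case (Z = 0) trivial. The invariant reference law of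
the whole route. [difficulty: S] [provable-now] -/
@[route_item "route-AtomisticToContinuum-PesinDefectPricing"]
def GibbsInvariance : Prop :=
  ∀ (σ θe : ℝ) (N : ℕ) (Φ : Literature.Analysis.FluidPDE.HardSphereFlow (Literature.Analysis.FluidPDE.Torus.geometry (Fin 3)) (Literature.MathematicalPhysics.KineticTheory.hsDiameter σ N) (N + 1)) (t : ℝ), 0 < θe → MeasureTheory.MeasurePreserving (Φ.flow t) (Literature.MathematicalPhysics.KineticTheory.localGibbsLaw σ (fun _ => 1) (fun _ => 0) (fun _ => θe) N Φ) (Literature.MathematicalPhysics.KineticTheory.localGibbsLaw σ (fun _ => 1) (fun _ => 0) (fun _ => θe) N Φ)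

-- item stmt-AtomisticToContinuum-8210 · support · rank 9 · closed · moot by None · by planner — informal only, no Lean statement yet:
--   [support] THE PRICING GLUE — BOLTZMANN HYPOTHESIS FOR THE STATES THAT OCCUR (card
--   pesin-defect-prices-u-regularity §Assembly; rank 9; INFORMAL until the definition requests land).
--   CLAIM: GibbsInvariance (stmt-AtomisticToContinuum-3926) ∧ TransferInequality
--   (stmt-AtomisticToContinuum-3924) ∧ UpperVolumeLemma ∧ KiferYoungUpper ∧ PesinSaturationRigidity(a) ⇒
--   for σ < σ₀, continuous local-Gibbs profiles (a₀, u₀, θ₀) (take θe > sup θ₀ / 2 in G_N), and any 0 ≤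
--   t₁ < t₂: every subsequential local limit ν (in the sense of URegularLimits
--   stmt-AtomisticToContinuum-5102 (i)–(iii): tag a typical particle, r

-- item stmt-AtomisticToContinuum-8211 · support · rank 9 · closed · moot by None · by planner — informal only, no Lean statement yet:
--   [support] ZERO-EXPONENT CLASSIFICATION (card pesin-defect-prices-u-regularity support 5; rank 9; the
--   pathwise half is typable over Literature.Analysis.FluidPDE.IsHardSphereTrajectory once a two-body
--   derivative lemma for collidePair ∘ freeFlight is in the library, the measure half over
--   HardSphereFlow + localGibbsLaw). (i) PATHWISE EXPANSION: for a hard-sphere trajectory on 𝕋³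
--   (diameter ε) and a NON-GRAZING collision of the pair (i, j) at time t_c (|cos φ| ≥ 1/2) followed by
--   joint free flight of the pair for time τ⁺, the two-body map 'transverse impact offset δb ⊥ n̂ at t_c
--   ↦ relative position o

/-- item stmt-AtomisticToContinuum-0769 · assembly · rank 1 · open · by planner
sources: KipnisLandim1999, OllaVaradhanYau1993
[assembly] X_RE → HydrodynamicLimit: entropy inequality μ(A) ≤ (log 2 + H(μ|λ))/log(1 + 1/λ(A))
(from Donsker–Varadhan / Mathlib klDiv API) with λ(A) ≤ C e^{-(N+1)/C} and H = o(N) gives μ(A) → 0;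
μ = lawAt (Φ N) P t = P.map (flow t) turns μ{z | δ < |field z − ·|} into P{z | δ < |field (flow t z)
− ·|} (measurable_flow); the reference concentration is stated for z itself and TendstoHydroFieldsAt
at time 0 of the reference law is not needed. Zero-mass case impossible by the IsProbabilityMeasure
clauses; take σ₀ from X_RE. -/
@[route_item "route-AtomisticToContinuum-PesinDefectPricing"]
def Assembly : Prop :=
  RelEntropyVanishing → Literature.MathematicalPhysics.KineticTheory.HydrodynamicLimit

end Summit.AtomisticToContinuum.HydrodynamicLimit.Theses.PesinDefectPricing
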